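import Literature.Algebra.Homology.NatCochainSixTerm
import Literature.Algebra.Homology.NatCochainCokernelSequence
import HarnessLib

/-!
# The dimension count of a pencil: `h⁰ ≠ 0` from two commuting twists and a skyscraper base

J.-P. Serre, *Géométrie algébrique et géométrie analytique* (1956), n° 16 Lemme 8 (after
*Faisceaux algébriques cohérents* (1955), n° 66 and n° 81): for a coherent sheaf `𝓕` on a
projective surface and two hyperplane sections `t = 0`, `t' = 0` in general position, the exact
sequences `0 → 𝓕(m) →ᵗ 𝓕(m+1) → 𝓕_C(m+1) → 0` (restriction to the curve `C = {t = 0}`) and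
`0 → 𝓕_C(m) →ᵗ' 𝓕_C(m+1) → 𝓕_Z(m+1) → 0` (restriction to the finite set `Z = C ∩ {t' = 0}`)
give, by the six-term dimension inequalities and the non-vanishing of the skyscraper `𝓕_Z`, that
`h⁰(𝓕(m)) → ∞`.

This file is the ABSTRACT form of that count for a "pencil tower" of cochain complexes of vector
spaces (`NatCochain.PencilTower`): complexes `F(m)` (`m ∈ ℕ`; in the application the Čech complexes
`C•(𝔙, 𝒪(L ⊗ 𝒪(mH)))` on one framed cover) with

* injective cochain maps `t_m : F(m) → F(m+1)` (multiplication by the equation of `C`),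
* cochain maps `t'_m : F(m) → F(m+1)` commuting with them (`t'_{m+1} t_m = t_{m+1} t'_m`) and
  REGULAR modulo `t` (`t'_{m+1} x ∈ t_{m+1} F(m+1) ⟹ x ∈ t_m F(m)`: `(t, t')` is a regular pair),
* surjective cochain maps `ev_m : F(m+2) → Z(m)` onto complexes `Z(m)` (the skyscraper complexes
  at `Z`) with `ker ev_m = t_{m+1} F(m+1) + t'_{m+1} F(m+1)` degreewise.

Then the curve level `Q(m) = F(m+1)/t_m F(m)` (`PencilTower.dQ`, `seqQ`) carries the injective
cochain maps `u_m : Q(m) → Q(m+1)` induced by `t'` (`Coker.map`, `injective_u`), the point level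
`R(m) = Q(m+1)/u_m Q(m)` (`dR`, `seqR`) is canonically ISOMORPHIC to `Z(m)` as a complex
(`toZ`, `toZ_bijective`, `cohomologyREquiv` — two surjections from `F(m+2)` with the same kernel),
finiteness of `H^k(F(m))` propagates to `H^k(Q(m))` along the long exact sequences
(`finiteDimensional_cohomologyQ`), and the tower count `exists_pos_h0_of_euler_inequalities`
(file `EulerInequalityGrowth`) fed with the two six-term inequalities
(`ShortExactSeq.finrank_six_term_le`, file `NatCochainSixTerm`) yields

* `PencilTower.exists_pos_finrank_cohomology_zero`: if all `H^k(F(m))` and `H⁰(Z(m)), H¹(Z(m))`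
  are finite-dimensional and `h¹(Z(m)) < h⁰(Z(m))` for all `m`, then `h⁰(F(m+1)) > 0` for some `m`;
* `PencilTower.exists_lt_finrank_cohomology_zero`: indeed `h⁰(F(m+1))` is unbounded.

Everything is proved; pure linear algebra (no sheaves, no geometry). The geometric inputs of the
application — injectivity of `t` (identity principle), regularity of `(t, t')` (a transversal pair
is a regular pair), `ker ev = (t, t')` and the surjectivity of `ev` (local Nullstellensatz and
interpolation at a transversal finite set), `h¹(Z) = 0 < h⁰(Z)` (a skyscraper is flasque and
non-zero) and the Cartan–Serre finiteness of `H^k(F(m))` — are exactly the fields / hypotheses.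

## References

* J.-P. Serre, *Géométrie algébrique et géométrie analytique*, Ann. Inst. Fourier 6 (1956), n° 16
  Lemme 8. [SerreGAGA1956]
* J.-P. Serre, *Faisceaux algébriques cohérents*, Ann. of Math. 61 (1955), n° 66, n° 81.
  [SerreFAC1955]
* C. A. Weibel, *An Introduction to Homological Algebra* (1994), Thm. 1.3.1. [Weibel1994]
-/

namespace Literature.Algebra.Homology

universe u w w'

open Function Module

namespace NatCochain

variable {K : Type u} [Field K]
  {F : ℕ → ℕ → Type w} [∀ m k, AddCommGroup (F m k)] [∀ m k, Module K (F m k)]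
  {Z : ℕ → ℕ → Type w'} [∀ m k, AddCommGroup (Z m k)] [∀ m k, Module K (Z m k)]

/-! ### Finiteness of the middle term of an exact triple -/

omit [∀ m k, AddCommGroup (F m k)] [∀ m k, Module K (F m k)]
  [∀ m k, AddCommGroup (Z m k)] [∀ m k, Module K (Z m k)] in
/-- The middle term of an exact `A → B → C` of vector spaces with finite-dimensional outer terms is
finite-dimensional. [folklore] -/
theorem finiteDimensional_of_exact {A B C : Type*} [AddCommGroup A] [Module K A]
    [AddCommGroup B] [Module K B] [AddCommGroup C] [Module K C]
    [FiniteDimensional K A] [FiniteDimensional K C] (f : A →ₗ[K] B) (g : B →ₗ[K] C)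
    (h : Exact f g) : FiniteDimensional K B := by
  have h' : Exact f g.rangeRestrict := by
    intro b
    rw [← h b, ← LinearMap.mem_ker, ← LinearMap.mem_ker, LinearMap.ker_rangeRestrict]
  exact Module.Finite.of_exact h' g.surjective_rangeRestrict

/-! ### Pencil towers -/

/-- **A pencil tower of cochain complexes** over the complexes `(F(m), d_m)` with base complexes
`(Z(m), dZ_m)`: injective cochain maps `t_m : F(m) → F(m+1)`, cochain maps `t'_m` commuting with
them and regular modulo `t` (`t'_{m+1} x ∈ im t_{m+1} ⟹ x ∈ im t_m`), and surjective cochain maps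
`ev_m : F(m+2) → Z(m)` with `ker ev_m = im t_{m+1} + im t'_{m+1}` — the shape of the Čech complexes
of `𝓕(m) = 𝓕 ⊗ 𝒪(mH)` on a projective surface with the multiplications by two transversal
sections `t, t'` of `𝒪(H)` and the restriction to their common zeros (Serre's Lemme 8).
[cite: SerreGAGA1956, n° 16 Lemme 8] -/
structure PencilTower (d : ∀ m k, F m k →ₗ[K] F m (k + 1))
    (dZ : ∀ m k, Z m k →ₗ[K] Z m (k + 1)) where
  /-- multiplication by the first section, `t_m : F(m) → F(m+1)` -/
  t : ∀ m k, F m k →ₗ[K] F (m + 1) k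
  /-- multiplication by the second section, `t'_m : F(m) → F(m+1)` -/
  t' : ∀ m k, F m k →ₗ[K] F (m + 1) k
  /-- restriction to the common zero set, `ev_m : F(m+2) → Z(m)` -/
  ev : ∀ m k, F (m + 2) k →ₗ[K] Z m k
  /-- each `F(m)` is a complex -/
  d_d : ∀ m k (x : F m k), d m (k + 1) (d m k x) = 0
  /-- `t` is a cochain map -/
  comm_t : ∀ m k (x : F m k), t m (k + 1) (d m k x) = d (m + 1) k (t m k x)
  /-- `t'` is a cochain map -/
  comm_t' : ∀ m k (x : F m k), t' m (k + 1) (d m k x) = d (m + 1) k (t' m k x)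
  /-- `t` and `t'` commute: `t'_{m+1} t_m = t_{m+1} t'_m` -/
  t'_t : ∀ m k (x : F m k), t' (m + 1) k (t m k x) = t (m + 1) k (t' m k x)
  /-- `t` is injective in every degree -/
  injective_t : ∀ m k, Injective (t m k)
  /-- `t'` is a non-zero-divisor modulo `t`: `t'_{m+1} x ∈ im t_{m+1} ⟹ x ∈ im t_m` -/
  regular : ∀ m k (x : F (m + 1) k),
    t' (m + 1) k x ∈ LinearMap.range (t (m + 1) k) → x ∈ LinearMap.range (t m k)
  /-- `ev` is a cochain map -/
  comm_ev : ∀ m k (x : F (m + 2) k), ev m (k + 1) (d (m + 2) k x) = dZ m k (ev m k x)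
  /-- `ev` is surjective in every degree -/
  surjective_ev : ∀ m k, Surjective (ev m k)
  /-- `ker ev_m = im t_{m+1} + im t'_{m+1}` in every degree -/
  ker_ev : ∀ m k, LinearMap.ker (ev m k) =
    LinearMap.range (t (m + 1) k) ⊔ LinearMap.range (t' (m + 1) k)

namespace PencilTower

variable {d : ∀ m k, F m k →ₗ[K] F m (k + 1)} {dZ : ∀ m k, Z m k →ₗ[K] Z m (k + 1)}
  (P : PencilTower d dZ)

/-! ### The curve level `Q(m) = F(m+1) / t F(m)` -/

/-- **The curve level** `Q(m)ᵏ = F(m+1)ᵏ ⧸ t_m F(m)ᵏ` (the Čech cochains of `𝓕_C(m+1)`).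
[cite: SerreGAGA1956, n° 16 Lemme 8] -/
abbrev Q (m k : ℕ) : Type w :=
  Coker (P.t m) k

/-- The differential of the curve level. [cite: Weibel1994, Ex. 1.1.1] -/
def dQ (m : ℕ) : ∀ k, P.Q m k →ₗ[K] P.Q m (k + 1) :=
  cokerD (P.t m) (P.comm_t m)

/-- The differential of the curve level on classes. [folklore] -/
@[simp]
theorem dQ_mk (m k : ℕ) (x : F (m + 1) k) :
    P.dQ m k (Submodule.Quotient.mk x) = Submodule.Quotient.mk (d (m + 1) k x) :=
  rfl

/-- The curve level is a complex. [folklore] -/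
theorem dQ_dQ (m k : ℕ) (c : P.Q m k) : P.dQ m (k + 1) (P.dQ m k c) = 0 :=
  cokerD_cokerD (P.t m) (P.comm_t m) (P.d_d (m + 1)) k c

/-- **The first short exact sequence** `0 → F(m) →ᵗ F(m+1) → Q(m) → 0`.
[cite: SerreGAGA1956, n° 16 Lemme 8] -/
def seqQ (m : ℕ) : ShortExactSeq (d m) (d (m + 1)) (P.dQ m) :=
  cokerSeq (P.t m) (P.comm_t m) (P.injective_t m) (P.d_d (m + 1))

/-! ### Multiplication by `t'` on the curve level -/

/-- **`u_m : Q(m) → Q(m+1)`**, the map induced by `t'` on the cokernels of `t`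
(`[x] ↦ [t'_{m+1} x]`). [cite: SerreGAGA1956, n° 16 Lemme 8] -/
def u (m : ℕ) (k : ℕ) : P.Q m k →ₗ[K] P.Q (m + 1) k :=
  Coker.map (f := P.t m) (f' := P.t (m + 1)) (P.t' m) (P.t' (m + 1)) (P.t'_t m) k

/-- `u` on classes. [folklore] -/
@[simp]
theorem u_mk (m k : ℕ) (x : F (m + 1) k) :
    P.u m k (Submodule.Quotient.mk x) = Submodule.Quotient.mk (P.t' (m + 1) k x) :=
  rfl

/-- `u` is a cochain map. [folklore] -/
theorem u_comm (m k : ℕ) (c : P.Q m k) :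
    P.u m (k + 1) (P.dQ m k c) = P.dQ (m + 1) k (P.u m k c) :=
  Coker.map_comm (P.comm_t m) (P.comm_t (m + 1)) (P.t' m) (P.t' (m + 1)) (P.t'_t m)
    (P.comm_t' (m + 1)) k c

/-- **`u` is injective** (`t'` is a non-zero-divisor modulo `t`). [cite: SerreGAGA1956, n° 16 Lemme 8] -/
theorem injective_u (m k : ℕ) : Injective (P.u m k) :=
  Coker.injective_map (P.t' m) (P.t' (m + 1)) (P.t'_t m) k (P.regular m k)

/-! ### The point level `R(m) = Q(m+1) / u Q(m)` and its identification with `Z(m)` -/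

/-- **The point level** `R(m)ᵏ = Q(m+1)ᵏ ⧸ u_m Q(m)ᵏ` (the Čech cochains of `𝓕_Z(m+2)`).
[cite: SerreGAGA1956, n° 16 Lemme 8] -/
abbrev R (m k : ℕ) : Type w :=
  Coker (P.u m) k

/-- The differential of the point level. [cite: Weibel1994, Ex. 1.1.1] -/
def dR (m : ℕ) : ∀ k, P.R m k →ₗ[K] P.R m (k + 1) :=
  cokerD (P.u m) (P.u_comm m)

/-- **The second short exact sequence** `0 → Q(m) →ᵘ Q(m+1) → R(m) → 0`.
[cite: SerreGAGA1956, n° 16 Lemme 8] -/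
def seqR (m : ℕ) : ShortExactSeq (P.dQ m) (P.dQ (m + 1)) (P.dR m) :=
  cokerSeq (P.u m) (P.u_comm m) (P.injective_u m) (P.dQ_dQ (m + 1))

/-- The composite quotient map `F(m+2)ᵏ → Q(m+1)ᵏ → R(m)ᵏ`. [folklore] -/
def toR (m k : ℕ) : F (m + 2) k →ₗ[K] P.R m k :=
  (LinearMap.range (P.u m k)).mkQ ∘ₗ (LinearMap.range (P.t (m + 1) k)).mkQ

/-- `toR` on elements. [folklore] -/
theorem toR_apply (m k : ℕ) (x : F (m + 2) k) :
    P.toR m k x = Submodule.Quotient.mk (Submodule.Quotient.mk x) :=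
  rfl

/-- `toR` is surjective. [folklore] -/
theorem toR_surjective (m k : ℕ) : Surjective (P.toR m k) :=
  (Submodule.mkQ_surjective _).comp (Submodule.mkQ_surjective _)

/-- **The kernel of `F(m+2) → R(m)` is `im t_{m+1} + im t'_{m+1}`.** [folklore] -/
theorem mem_ker_toR_iff (m k : ℕ) (x : F (m + 2) k) :
    x ∈ LinearMap.ker (P.toR m k) ↔
      x ∈ LinearMap.range (P.t (m + 1) k) ⊔ LinearMap.range (P.t' (m + 1) k) := by
  rw [LinearMap.mem_ker, toR_apply, Submodule.Quotient.mk_eq_zero, u,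
    Coker.mk_mem_range_map_iff, sup_comm]

/-- `toR` is a cochain map. [folklore] -/
theorem toR_comm (m k : ℕ) (x : F (m + 2) k) :
    P.toR m (k + 1) (d (m + 2) k x) = P.dR m k (P.toR m k x) :=
  rfl

/-- `ev` factors through the curve level `Q(m+1)`. [folklore] -/
def evQ (m k : ℕ) : P.Q (m + 1) k →ₗ[K] Z m k :=
  (LinearMap.range (P.t (m + 1) k)).liftQ (P.ev m k) (by rw [P.ker_ev]; exact le_sup_left)

/-- `evQ` on classes. [folklore] -/
@[simp]
theorem evQ_mk (m k : ℕ) (x : F (m + 2) k) : P.evQ m k (Submodule.Quotient.mk x) = P.ev m k x :=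
  rfl

/-- **The comparison map `R(m) → Z(m)`** induced by `ev` (which kills `im t + im t'`).
[cite: SerreGAGA1956, n° 16 Lemme 8] -/
def toZ (m k : ℕ) : P.R m k →ₗ[K] Z m k :=
  (LinearMap.range (P.u m k)).liftQ (P.evQ m k) (by
    rintro _ ⟨c, rfl⟩
    obtain ⟨y, rfl⟩ := Submodule.Quotient.mk_surjective _ c
    rw [LinearMap.mem_ker, u_mk, evQ_mk, ← LinearMap.mem_ker, P.ker_ev]
    exact Submodule.mem_sup_right ⟨y, rfl⟩)

/-- `toZ ∘ toR = ev`. [folklore] -/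
@[simp]
theorem toZ_toR (m k : ℕ) (x : F (m + 2) k) : P.toZ m k (P.toR m k x) = P.ev m k x :=
  rfl

/-- **`R(m) → Z(m)` is bijective in every degree** (two surjections from `F(m+2)` with the same
kernel). [cite: SerreGAGA1956, n° 16 Lemme 8] -/
theorem toZ_bijective (m k : ℕ) : Bijective (P.toZ m k) := by
  constructor
  · rw [← LinearMap.ker_eq_bot, Submodule.eq_bot_iff]
    intro c hc
    obtain ⟨x, rfl⟩ := P.toR_surjective m k c
    rw [LinearMap.mem_ker, toZ_toR, ← LinearMap.mem_ker, P.ker_ev, ← mem_ker_toR_iff,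
      LinearMap.mem_ker] at hc
    exact hc
  · intro z
    obtain ⟨x, rfl⟩ := P.surjective_ev m k z
    exact ⟨P.toR m k x, P.toZ_toR m k x⟩

/-- `toZ` is a cochain map. [folklore] -/
theorem toZ_comm (m k : ℕ) (c : P.R m k) :
    P.toZ m (k + 1) (P.dR m k c) = dZ m k (P.toZ m k c) := by
  obtain ⟨x, rfl⟩ := P.toR_surjective m k c
  rw [← toR_comm, toZ_toR, toZ_toR, P.comm_ev]

/-- **`H^k(R(m)) ≃ H^k(Z(m))`**: the point level computes the cohomology of the skyscraper.
[cite: SerreGAGA1956, n° 16 Lemme 8] -/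
noncomputable def cohomologyREquiv (m k : ℕ) : Cohomology (P.dR m) k ≃ₗ[K] Cohomology (dZ m) k :=
  Cohomology.equivOfBijective (P.toZ m) (P.toZ_comm m) (P.toZ_bijective m) k

/-- `h^k(R(m)) = h^k(Z(m))`. [folklore] -/
theorem finrank_cohomologyR (m k : ℕ) :
    finrank K (Cohomology (P.dR m) k) = finrank K (Cohomology (dZ m) k) :=
  (P.cohomologyREquiv m k).finrank_eq

/-- `H^k(R(m))` is finite-dimensional when `H^k(Z(m))` is. [folklore] -/
theorem finiteDimensional_cohomologyR {m k : ℕ} (h : FiniteDimensional K (Cohomology (dZ m) k)) :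
    FiniteDimensional K (Cohomology (P.dR m) k) :=
  LinearEquiv.finiteDimensional (P.cohomologyREquiv m k).symm

/-! ### Finiteness of the curve level -/

/-- **`H^k(Q(m))` is finite-dimensional** if `H^k(F(m+1))` and `H^{k+1}(F(m))` are (exactness of
`H^k(F(m+1)) → H^k(Q(m)) → H^{k+1}(F(m))`). [cite: Weibel1994, Thm. 1.3.1] -/
theorem finiteDimensional_cohomologyQ {m k : ℕ}
    (h₁ : FiniteDimensional K (Cohomology (d (m + 1)) k))
    (h₂ : FiniteDimensional K (Cohomology (d m) (k + 1))) :
    FiniteDimensional K (Cohomology (P.dQ m) k) :=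
  finiteDimensional_of_exact _ _ ((P.seqQ m).exact_map_delta k)

/-! ### The dimension count -/

section Count

variable (hF : ∀ m k, FiniteDimensional K (Cohomology (d m) k))
  (hZ₀ : ∀ m, FiniteDimensional K (Cohomology (dZ m) 0))
  (hZ₁ : ∀ m, FiniteDimensional K (Cohomology (dZ m) 1))

/-- The `h⁰`-table of the tower: level `2` = `F(m+1)`, level `1` = `Q(m)`, level `0` = `Z(m-1)`
(and `Z(0)` at `m = 0`, a harmless filler). [folklore] -/
noncomputable def h0 : ℕ → ℕ → ℕ
  | 0, 0 => finrank K (Cohomology (dZ 0) 0)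
  | 0, m + 1 => finrank K (Cohomology (dZ m) 0)
  | 1, m => finrank K (Cohomology (P.dQ m) 0)
  | _ + 2, m => finrank K (Cohomology (d (m + 1)) 0)

/-- The `h¹`-table of the tower (same indexing as `h0`). [folklore] -/
noncomputable def h1 : ℕ → ℕ → ℕ
  | 0, 0 => finrank K (Cohomology (dZ 0) 1)
  | 0, m + 1 => finrank K (Cohomology (dZ m) 1)
  | 1, m => finrank K (Cohomology (P.dQ m) 1)
  | _ + 2, m => finrank K (Cohomology (d (m + 1)) 1)

include hF hZ₀ hZ₁ in
/-- **The two six-term inequalities of the tower** in the format of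
`exists_pos_h0_of_euler_inequalities` (level `1`: the sequence `seqQ (m+1)`; level `0`: the
sequence `seqR m` with `h^k(R(m)) = h^k(Z(m))`). [cite: SerreGAGA1956, n° 16 Lemme 8 (dimension count)] -/
theorem hstep : ∀ j < 2, ∀ m,
    P.h0 (j + 1) m + P.h0 j (m + 1) + P.h1 (j + 1) (m + 1) ≤
      P.h0 (j + 1) (m + 1) + P.h1 (j + 1) m + P.h1 j (m + 1) := by
  intro j hj m
  have hQ : ∀ m k, FiniteDimensional K (Cohomology (P.dQ m) k) := fun m k ↦
    P.finiteDimensional_cohomologyQ (hF (m + 1) k) (hF m (k + 1))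
  interval_cases j
  · -- level `0`: `0 → Q(m) → Q(m+1) → R(m) → 0`, `R(m) ≅ Z(m)`
    haveI := hQ m 1
    haveI := hQ (m + 1) 0
    haveI := hQ (m + 1) 1
    haveI := P.finiteDimensional_cohomologyR (hZ₀ m)
    haveI := P.finiteDimensional_cohomologyR (hZ₁ m)
    have h := (P.seqR m).finrank_six_term_le
    rw [P.finrank_cohomologyR m 0, P.finrank_cohomologyR m 1] at h
    exact h
  · -- level `1`: `0 → F(m+1) → F(m+2) → Q(m+1) → 0`
    haveI := hF (m + 1) 1
    haveI := hF (m + 2) 0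
    haveI := hF (m + 2) 1
    haveI := hQ (m + 1) 0
    haveI := hQ (m + 1) 1
    exact (P.seqQ (m + 1)).finrank_six_term_le

/-- The base inequality in the format of `exists_pos_h0_of_euler_inequalities`. [folklore] -/
theorem hbase (hbase : ∀ m, finrank K (Cohomology (dZ m) 1) < finrank K (Cohomology (dZ m) 0)) :
    ∀ m, P.h1 0 m < P.h0 0 m
  | 0 => hbase 0
  | m + 1 => hbase m

include P hF hZ₀ hZ₁ in
/-- **Serre's dimension count for a pencil tower**: if every `H^k(F(m))` and `H⁰(Z(m)), H¹(Z(m))`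
are finite-dimensional and `h¹(Z(m)) < h⁰(Z(m))` for all `m` (a non-zero skyscraper has no higher
cohomology), then `H⁰(F(m+1)) ≠ 0` for some `m` — some twist has a non-zero section.
[cite: SerreGAGA1956, n° 16 Lemme 8] -/
theorem exists_pos_finrank_cohomology_zero
    (hbase : ∀ m, finrank K (Cohomology (dZ m) 1) < finrank K (Cohomology (dZ m) 0)) :
    ∃ m, 0 < finrank K (Cohomology (d (m + 1)) 0) :=
  exists_pos_h0_of_euler_inequalities 2 P.h0 P.h1 (P.hstep hF hZ₀ hZ₁) (P.hbase hbase)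

include P hF hZ₀ hZ₁ in
/-- **Serre's dimension count for a pencil tower, growth form**: under the same hypotheses
`h⁰(F(m+1))` is unbounded. [cite: SerreGAGA1956, n° 16 Lemme 8] -/
theorem exists_lt_finrank_cohomology_zero
    (hbase : ∀ m, finrank K (Cohomology (dZ m) 1) < finrank K (Cohomology (dZ m) 0)) (B : ℕ) :
    ∃ m, B < finrank K (Cohomology (d (m + 1)) 0) :=
  exists_lt_h0_of_euler_inequalities (n := 2) (by norm_num) P.h0 P.h1 (P.hstep hF hZ₀ hZ₁)
    (P.hbase hbase) B

end Count

end PencilTower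

end NatCochain

end Literature.Algebra.Homology
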